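import Summits.QuantumFields.BalabanUV.Beta.GAN24.VHWordsZeroBorder
import Summits.QuantumFields.BalabanUV.Beta.GAN24.CombLin4Transport
import Summits.QuantumFields.BalabanUV.Beta.GAN24.CombTransportZeroMode
import Summits.QuantumFields.BalabanUV.Beta.SymAveragingHessianCounts

/-!
# `BalabanUV.Beta.GAN24.CombTransportedBorder` — binder row G-an2-4 ∕ (CONV-C), TRANSFER-III, the (III′) (C)-campaign's supplier `hB0` (memo M-1 §2 row `hB0`, VALUE side):
# **THE TRANSPORTED SYM BORDER SECTOR `𝒯(c • symVhSAt ρ_c)` HAS leaf-04's FIVE BORDER-TABLE PROPERTIES, HENCE 26 AT THE COMB DATA — THE `VH ⊗ VH` SECTOR WORDS OF THE COMB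
# FORCING's ff CELL CHARGE VANISH AT EVERY LEVEL, EVERY PERIOD, BOND BY BOND IN THE CELL**
# (G-an2-4 CRUX TEAM (2), leaf prover `b2b-balaban-gan24-formalise-leaf-01`, gen 85; journal [LEAF01-G85-INTENT-3])

NOT IN PRINT; OUR BOOKKEEPING ([folklore] kernel bookkeeping BY NAME: the units commute with the slot-and-leg transport (road FP's `comp_scaleK_of_comm ∕ scaleK_comp_of_comm` with leaf-03 g79's
`psiKS_mul_legScale ∕ legScale_mul_trK_psiKS`); the transport preserves «no ff block», block covariance (d1-leaf-03's `slotPsiS_shift` ⨾ leaf-01 g84's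
`conj_psiKS_shiftK`) and «multiplier legs on the coarse lattice» (`Ψ̂_S`'s identity multiplier block: `psiKS_inr_inr ∕ _inl_inr ∕ _inr_inl`), and keeps local stencil families (road-P2 M.43
`locStencil_transportPsiS`); an1's `symVhSAt` letters (`locStencil_symVhSAt`, `symVhSAt_translate`, `packVH_*`); then leaf-04 g66's GENERIC 26 `VHWordsZeroBorder.sum_box_border_border_words_eq_zero`
at the bm kernel `X̃_i` (leaf-01 g85's (Q1) puts the comb forcing there); 0 `def`, 0 cited fact, 0 `def … : Prop`, 0 sorry).
HONEST FRAMING (cell contract, verbatim): «discharging `BetaPertH` makes Bałaban's UV stability UNCONDITIONAL — a real constructive-QFT result; it is NOT the continuum limit and NOT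
the Clay problem.»  HONEST DEPENDENCY (verbatim): «continuum YM on T⁴ ⇐ BetaPertH ∧ nine spine estimates (0/9 proved); BetaPertH ⇐ (D1) ∧ (D4) ∧ CAP+tail; G-an2-4 gates asym, D1
and NE2/3/4.»

## What is proved (generic `d`; `𝒯S κ u := Ψ̂ᵀ ∘ slotPsiS r n S κ u ∘ Ψ̂`, `Ψ̂ = psiKS r n`; at the comb data `r = ctrOff (d+1) Lc`, `n = Lc`, `ρ_c = ctr (d+1) Lc`)
* §1 `slotPsiS_unitS`, `conj_counitK`, **`transport_unitS`** (`𝒯 (unitS s_f s_m S) = unitS s_f s_m (𝒯 S)` — the units commute with the transport).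
* §2 (ANY table `S`) `slotPsiS_entry_eq_zero`; **`transport_inl_inl`** (no ff block is kept), **`transport_translate`** (block covariance is kept), **`transport_inr_fst_eq_zero`** ∕
  **`transport_inr_snd_eq_zero`** (coarse support of the multiplier legs is kept).
* §3 (the sym border `S^VH_c κ v := c • symVhSAt ρ_c d Lc κ v`, any `c`) `locStencil_symVhS`, `symVhS_inl_inl`, `symVhS_translate`, `symVhS_inr_fst_eq_zero`, `symVhS_inr_snd_eq_zero`,
  `exists_locStencil_transport_symVhS` — an1's `symVhSAt` has leaf-04's five border-table properties (same `packVH` as `vhSAt`), and so has `𝒯 S^VH_c`.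
* §4 **`sum_box_symVhS_symVhS_words_eq_zero`** — 26 AT THE COMB DATA: for every level `j`, period `N`, units, `c`, axes `μ ν α β`, with `X̃_j = unitK s_f s_m (coDressKBmAt ρ_c Lc (KInvStep Lc j))`
  and `Q_b := vertexOfK X̃_j Lc (unitS s_f s_m (𝒯 S^VH_c)) b`: `Σ_{c ∈ box N} Σ'_{u′} FF[(Q_{(μ,c)} ∘ X̃_j) ∘ Q_{(ν,u′)}] = 0 ∧ Σ_{c ∈ box N} Σ'_{u′} FF[(Q_{(ν,u′)} ∘ X̃_j) ∘ Q_{(μ,c)}] = 0`.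
WHAT THIS IS NOT: the `E ⊗ VH`, `VH ⊗ E`, `E ⊗ E` and `K·W·K` words of the comb forcing's cell charge are NOT touched (24 ∕ 27 ∕ J2 ∕ 32+(L3c) at the comb data are the campaign); the sector split of
`𝒯 S̃′_{j+1}` (30's twin) is NOT assembled here; NO value of any table or charge; NOT `hB0`, NOT (d′)∕(d″); the (III′) campaign is NOT asked (an2 W-4); NEVER «G-an2-4 closed» as (CONV-C);
NOT D1, NOT `BetaPertH`, NOT continuum, NOT Clay.  2026-08-27; no existing file touched.
-/

noncomputable section

open Finset
open scoped BigOperators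
open Literature.MathematicalPhysics.QuantumFieldTheory
open Literature.MathematicalPhysics.QuantumFieldTheory.Balaban1983to89
open Literature.MathematicalPhysics.QuantumFieldTheory.Balaban1983to89.Beta
open B12Sec2to5 (l1 l1_nonneg)
open ExpKernelCalculus (Site MKer Decays BiLoc comp shiftK Zl Zl_nonneg)
open OneStepResolventKernel (Fib LocStencil biLoc_mono)
open OneStepKernelFamily (KInvStep vertexOfK)
open HessKerRate (scaleK)
open StepJetData (locStencil_smul)
open AffineAveraging (box toSite)
open AveragingContours (off)
open AveragingContoursRooted (ctr ctrOff ctrOff_mem_box)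
open AveragingHessianKernels (ell packVH_inl_inr packVH_inr_inl packVH_inl_inl packVH_inr_inr)
open Summit.QuantumFields.BalabanUV.Beta.TameKernelCalculus
open Summit.QuantumFields.BalabanUV.Beta.AxialDressingRooted (coDressKBmAt)
open Summit.QuantumFields.BalabanUV.Beta.HessKerDressedUnits (unitK unitS counitK legScale)
open Summit.QuantumFields.BalabanUV.Beta.SymAveragingHessianCounts (symVhSAt locStencil_symVhSAt symVhSAt_translate)
open Summit.QuantumFields.BalabanUV.Beta.SymCorrectorKernel (psiKS psiKS_inr_inr psiKS_inl_inr psiKS_inr_inl spr_psiKS shiftK_psiKS)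
open Summit.QuantumFields.BalabanUV.Beta.SymCorrectorFace (slotPsiS slotPsiS_shift slotPsiS_apply_kernel)
open Summit.QuantumFields.BalabanUV.Beta.FP.NestedDressingKernel (comp_scaleK_of_comm scaleK_comp_of_comm)
open Summit.QuantumFields.BalabanUV.Beta.GAN24.CombLin4Transport (psiKS_mul_legScale legScale_mul_trK_psiKS)
open Summit.QuantumFields.BalabanUV.Beta.GAN24.CombTransportZeroMode (conj_psiKS_shiftK)
open Summit.QuantumFields.BalabanUV.Beta.GAN24.CombCubicStepTransport (locStencil_transportPsiS)
open Summit.QuantumFields.BalabanUV.Beta.GAN24.VHWordsZeroBorder (sum_box_border_border_words_eq_zero)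
open Summit.QuantumFields.BalabanUV.Beta.GAN24.ExchangeSlotResum (face_weight_periodic)
open Summit.QuantumFields.BalabanUV.Beta.GAN24.CombesThomas (sfStep smStep)

namespace Summit.QuantumFields.BalabanUV.Beta.GAN24.CombTransportedBorder

variable {d : ℕ}

/-! ## §1 The units commute with the slot-and-leg transport -/

section Units

variable (r : Fin (d + 1) → ℕ) (n : ℕ) (sf sm : ℝ)

/-- [folklore] `counitK` is linear: it commutes with the slot transport (`slotPsiS` is a finite linear combination of the family's members). -/
theorem slotPsiS_unitS (S : Fin (d + 1) → Site (d + 1) → MKer (d + 1) (Fib d)) :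
    slotPsiS r n (unitS sf sm S) = unitS sf sm (slotPsiS r n S) := by
  funext κ u x z a b
  simp only [slotPsiS_apply_kernel, SymCorrectorFace.slotPsiS_apply, HessKerDressedUnits.unitS_apply, smul_eq_mul, mul_add, add_mul, Finset.mul_sum,
    Finset.sum_mul]
  congr 1
  exact Finset.sum_congr rfl fun κ' _ => Finset.sum_congr rfl fun u' _ => by ring

/-- [folklore] **THE LEG CONGRUENCE COMMUTES WITH `counitK`** (`Ψ̂_S` is block-diagonal in the leg type: leaf-03 g79's `psiKS_mul_legScale ∕ legScale_mul_trK_psiKS` at the inverse units). -/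
theorem conj_counitK (X : MKer (d + 1) (Fib d)) :
    comp (comp (trK (psiKS r n)) (counitK sf sm X)) (psiKS r n) = counitK sf sm (comp (comp (trK (psiKS r n)) X) (psiKS r n)) := by
  unfold counitK
  rw [comp_scaleK_of_comm (fun x y a b => (legScale_mul_trK_psiKS n r sf⁻¹ sm⁻¹ x y a b).symm), scaleK_comp_of_comm (fun y z f c => (psiKS_mul_legScale n r sf⁻¹ sm⁻¹ y z f c).symm)]

/-- [folklore] **THE UNITS COMMUTE WITH THE TRANSPORT**: `𝒯 (unitS s_f s_m S) = unitS s_f s_m (𝒯 S)`. -/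
theorem transport_unitS (S : Fin (d + 1) → Site (d + 1) → MKer (d + 1) (Fib d)) :
    (fun κ u => comp (comp (trK (psiKS r n)) (slotPsiS r n (unitS sf sm S) κ u)) (psiKS r n))
      = unitS sf sm (fun κ u => comp (comp (trK (psiKS r n)) (slotPsiS r n S κ u)) (psiKS r n)) := by
  funext κ u
  rw [slotPsiS_unitS]
  show comp (comp (trK (psiKS r n)) ((sf * sm)⁻¹ • counitK sf sm (slotPsiS r n S κ u))) (psiKS r n) = (sf * sm)⁻¹ • counitK sf sm _
  rw [KernelReflection.comp_smul_right, KernelReflection.comp_smul_left, conj_counitK]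

end Units

/-! ## §2 The slot-and-leg transport preserves leaf-04's border-table properties -/

section Preserve

variable {n : ℕ} (r : Fin (d + 1) → ℕ) {S : Fin (d + 1) → Site (d + 1) → MKer (d + 1) (Fib d)}

/-- [folklore] A slot-transported table's entries are face-weighted combinations of the table's entries at the same legs: a leg-wise vanishing passes through `slotPsiS`. -/
theorem slotPsiS_entry_eq_zero {x z : Site (d + 1)} {a b : Fib d} (h : ∀ κ u, S κ u x z a b = 0) (κ : Fin (d + 1)) (u : Site (d + 1)) :
    slotPsiS r n S κ u x z a b = 0 := by
  rw [slotPsiS_apply_kernel]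
  have e : (fun κ u => S κ u x z a b) = 0 := by funext κ u; exact h κ u
  rw [e, SymCorrectorFace.slotPsiS_zero]
  rfl

/-- [folklore] **THE TRANSPORT KEEPS «NO FIELD–FIELD BLOCK»** (`Ψ̂_S`'s mixed blocks vanish: an ff entry of `Ψ̂ᵀ ∘ T ∘ Ψ̂` reads only ff entries of `T`). -/
theorem transport_inl_inl (hSff : ∀ (κ : Fin (d + 1)) (t x z : Site (d + 1)) (α' a : Fin (d + 1)), S κ t x z (Sum.inl α') (Sum.inl a) = 0)
    (κ : Fin (d + 1)) (t x z : Site (d + 1)) (α' a : Fin (d + 1)) :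
    comp (comp (trK (psiKS r n)) (slotPsiS r n S κ t)) (psiKS r n) x z (Sum.inl α') (Sum.inl a) = 0 := by
  have hT : ∀ (w y : Site (d + 1)) (γ β : Fin (d + 1)), slotPsiS r n S κ t w y (Sum.inl γ) (Sum.inl β) = 0 :=
    fun w y γ β => slotPsiS_entry_eq_zero r (fun κ u => hSff κ u w y γ β) κ t
  have inner : ∀ (y : Site (d + 1)) (β : Fin (d + 1)), comp (trK (psiKS r n)) (slotPsiS r n S κ t) x y (Sum.inl α') (Sum.inl β) = 0 := by
    intro y β
    show (∑' w, ∑ g, trK (psiKS r n) x w (Sum.inl α') g * slotPsiS r n S κ t w y g (Sum.inl β)) = 0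
    refine (tsum_congr fun w => ?_).trans tsum_zero
    refine Finset.sum_eq_zero fun g _ => ?_
    rcases g with γ | m
    · rw [hT, mul_zero]
    · rw [trK_apply, psiKS_inr_inl, zero_mul]
  show (∑' y, ∑ f, comp (trK (psiKS r n)) (slotPsiS r n S κ t) x y (Sum.inl α') f * psiKS r n y z f (Sum.inl a)) = 0
  refine (tsum_congr fun y => ?_).trans tsum_zero
  refine Finset.sum_eq_zero fun f _ => ?_
  rcases f with β | m
  · rw [inner, zero_mul]
  · rw [psiKS_inr_inl, mul_zero]

/-- [folklore] **THE TRANSPORT KEEPS BLOCK COVARIANCE** (d1-leaf-03's `slotPsiS_shift` ⨾ leaf-01 g84's `conj_psiKS_shiftK`). -/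
theorem transport_translate (hn : 0 < n) (hScov : ∀ (κ : Fin (d + 1)) (u t : Site (d + 1)), S κ (u + (n : ℤ) • t) = shiftK (-((n : ℤ) • t)) (S κ u))
    (κ : Fin (d + 1)) (u t : Site (d + 1)) :
    comp (comp (trK (psiKS r n)) (slotPsiS r n S κ (u + (n : ℤ) • t))) (psiKS r n) = shiftK (-((n : ℤ) • t)) (comp (comp (trK (psiKS r n)) (slotPsiS r n S κ u)) (psiKS r n)) := by
  rw [slotPsiS_shift hn r hScov κ u t, conj_psiKS_shiftK r hn]

/-- [folklore] **THE TRANSPORT KEEPS «MULTIPLIER FIRST LEGS ON THE COARSE LATTICE»** (`Ψ̂_S`'s multiplier block is the identity, its mixed blocks vanish). -/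
theorem transport_inr_fst_eq_zero (hS : ∀ (κ : Fin (d + 1)) (t z w : Site (d + 1)) (m : Fin (d + 1)) (b : Fib d), off n z ≠ 0 → S κ t z w (Sum.inr m) b = 0)
    (κ : Fin (d + 1)) (t z w : Site (d + 1)) (m : Fin (d + 1)) (b : Fib d) (hz : off n z ≠ 0) :
    comp (comp (trK (psiKS r n)) (slotPsiS r n S κ t)) (psiKS r n) z w (Sum.inr m) b = 0 := by
  have hT : ∀ (y : Site (d + 1)) (m' : Fin (d + 1)) (f : Fib d), slotPsiS r n S κ t z y (Sum.inr m') f = 0 :=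
    fun y m' f => slotPsiS_entry_eq_zero r (fun κ u => hS κ u z y m' f hz) κ t
  have inner : ∀ (y : Site (d + 1)) (f : Fib d), comp (trK (psiKS r n)) (slotPsiS r n S κ t) z y (Sum.inr m) f = 0 := by
    intro y f
    show (∑' x, ∑ g, trK (psiKS r n) z x (Sum.inr m) g * slotPsiS r n S κ t x y g f) = 0
    refine (tsum_congr fun x => ?_).trans tsum_zero
    refine Finset.sum_eq_zero fun g _ => ?_
    rcases g with γ | m'
    · rw [trK_apply, psiKS_inl_inr, zero_mul]
    · rw [trK_apply, psiKS_inr_inr]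
      by_cases hx : x = z ∧ m' = m
      · rw [hx.1, hT, mul_zero]
      · rw [if_neg hx, zero_mul]
  show (∑' y, ∑ f, comp (trK (psiKS r n)) (slotPsiS r n S κ t) z y (Sum.inr m) f * psiKS r n y w f b) = 0
  refine (tsum_congr fun y => ?_).trans tsum_zero
  exact Finset.sum_eq_zero fun f _ => by rw [inner, zero_mul]

/-- [folklore] **THE TRANSPORT KEEPS «MULTIPLIER SECOND LEGS ON THE COARSE LATTICE»**. -/
theorem transport_inr_snd_eq_zero (hS : ∀ (κ : Fin (d + 1)) (t z w : Site (d + 1)) (a : Fib d) (m : Fin (d + 1)), off n w ≠ 0 → S κ t z w a (Sum.inr m) = 0)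
    (κ : Fin (d + 1)) (t z w : Site (d + 1)) (a : Fib d) (m : Fin (d + 1)) (hw : off n w ≠ 0) :
    comp (comp (trK (psiKS r n)) (slotPsiS r n S κ t)) (psiKS r n) z w a (Sum.inr m) = 0 := by
  have hT : ∀ (x : Site (d + 1)) (g : Fib d) (m' : Fin (d + 1)), slotPsiS r n S κ t x w g (Sum.inr m') = 0 :=
    fun x g m' => slotPsiS_entry_eq_zero r (fun κ u => hS κ u x w g m' hw) κ t
  have inner : ∀ (m' : Fin (d + 1)), comp (trK (psiKS r n)) (slotPsiS r n S κ t) z w a (Sum.inr m') = 0 := by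
    intro m'
    show (∑' x, ∑ g, trK (psiKS r n) z x a g * slotPsiS r n S κ t x w g (Sum.inr m')) = 0
    refine (tsum_congr fun x => ?_).trans tsum_zero
    exact Finset.sum_eq_zero fun g _ => by rw [hT, mul_zero]
  show (∑' y, ∑ f, comp (trK (psiKS r n)) (slotPsiS r n S κ t) z y a f * psiKS r n y w f (Sum.inr m)) = 0
  refine (tsum_congr fun y => ?_).trans tsum_zero
  refine Finset.sum_eq_zero fun f _ => ?_
  rcases f with β | m'
  · rw [psiKS_inl_inr, mul_zero]
  · rw [psiKS_inr_inr]
    by_cases hy : y = w ∧ m' = m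
    · rw [hy.1, inner, zero_mul]
    · rw [if_neg hy, mul_zero]

end Preserve

/-! ## §3 The transported sym border sector at the comb data has the five properties -/

section Border

variable {Lc : ℕ} [NeZero Lc]

/-- [folklore] `0 < Lc`. -/
theorem pos_Lc : 0 < Lc := Nat.pos_of_ne_zero (NeZero.ne Lc)

/-- [folklore] The sym border sector `S^VH_c := κ v ↦ c • symVhSAt ρ_c d Lc κ v` is a local stencil family at every rate `δ ≥ 0` (an1's `locStencil_symVhSAt` ⨾ `locStencil_smul`). -/
theorem locStencil_symVhS (c : ℝ) {δ : ℝ} (hδ : 0 ≤ δ) :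
    LocStencil (fun κ v => c • symVhSAt (ctr (d + 1) Lc) d Lc rfl κ v) (|c| * (3 * (ell (d + 1) Lc : ℝ) ^ 2 * Real.exp (4 * ((d : ℝ) + 1) * Lc * δ))) δ :=
  locStencil_smul c (locStencil_symVhSAt (Nat.one_le_iff_ne_zero.mpr (NeZero.ne Lc)) (ctrOff_mem_box pos_Lc) hδ)

omit [NeZero Lc] in
/-- [folklore] `S^VH_c` has no field–field block (`packVH`). -/
theorem symVhS_inl_inl (c : ℝ) (κ' : Fin (d + 1)) (t x z : Site (d + 1)) (α' a : Fin (d + 1)) :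
    (c • symVhSAt (ctr (d + 1) Lc) d Lc rfl κ' t) x z (Sum.inl α') (Sum.inl a) = 0 := by
  simp only [Pi.smul_apply, smul_eq_mul, SymAveragingHessianCounts.symVhSAt_inl_inl, mul_zero]

omit [NeZero Lc] in
/-- [folklore] `S^VH_c` is block-covariant (an1's `symVhSAt_translate`). -/
theorem symVhS_translate (hLc : 1 ≤ Lc) (c : ℝ) (κ : Fin (d + 1)) (u t : Site (d + 1)) :
    (c • symVhSAt (ctr (d + 1) Lc) d Lc rfl κ (u + (Lc : ℤ) • t)) = shiftK (-((Lc : ℤ) • t)) (c • symVhSAt (ctr (d + 1) Lc) d Lc rfl κ u) := by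
  rw [symVhSAt_translate (ctr (d + 1) Lc) hLc κ u t]
  rfl

omit [NeZero Lc] in
/-- [folklore] The multiplier FIRST legs of `S^VH_c` sit on the coarse lattice (`packVH_inr_inl`'s guard; `packVH_inr_inr = 0`). -/
theorem symVhS_inr_fst_eq_zero (c : ℝ) (κ : Fin (d + 1)) (t z w : Site (d + 1)) (m : Fin (d + 1)) (b : Fib d) (hz : off Lc z ≠ 0) :
    (c • symVhSAt (ctr (d + 1) Lc) d Lc rfl κ t) z w (Sum.inr m) b = 0 := by
  rcases b with b | b
  · simp only [Pi.smul_apply, smul_eq_mul, symVhSAt, packVH_inr_inl, if_neg hz, mul_zero]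
  · simp only [Pi.smul_apply, smul_eq_mul, symVhSAt, packVH_inr_inr, mul_zero]

omit [NeZero Lc] in
/-- [folklore] The multiplier SECOND legs of `S^VH_c` sit on the coarse lattice (`packVH_inl_inr`'s guard; `packVH_inr_inr = 0`). -/
theorem symVhS_inr_snd_eq_zero (c : ℝ) (κ : Fin (d + 1)) (t z w : Site (d + 1)) (a : Fib d) (m : Fin (d + 1)) (hw : off Lc w ≠ 0) :
    (c • symVhSAt (ctr (d + 1) Lc) d Lc rfl κ t) z w a (Sum.inr m) = 0 := by
  rcases a with a | a
  · simp only [Pi.smul_apply, smul_eq_mul, symVhSAt, packVH_inl_inr, if_neg hw, mul_zero]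
  · simp only [Pi.smul_apply, smul_eq_mul, symVhSAt, packVH_inr_inr, mul_zero]

/-- [folklore] **THE TRANSPORTED SYM BORDER `𝒯 S^VH_c` IS A LOCAL STENCIL FAMILY** (road-P2 M.43 `locStencil_transportPsiS`). -/
theorem exists_locStencil_transport_symVhS (c : ℝ) :
    ∃ Cs δs : ℝ, 0 < δs ∧ LocStencil (fun κ v => comp (comp (trK (psiKS (ctrOff (d + 1) Lc) Lc))
      (slotPsiS (ctrOff (d + 1) Lc) Lc (fun κ v => c • symVhSAt (ctr (d + 1) Lc) d Lc rfl κ v) κ v)) (psiKS (ctrOff (d + 1) Lc) Lc)) Cs δs :=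
  locStencil_transportPsiS pos_Lc (ctrOff_mem_box pos_Lc) (locStencil_symVhS c zero_le_one) one_pos

end Border

/-! ## §4 26 at the comb data: the `VH ⊗ VH` sector words of the comb forcing's ff cell charge vanish -/

section Words

variable {Lc : ℕ} [NeZero Lc] {μ ν α β : Fin (d + 1)}

/-- NOT IN PRINT; OUR BOOKKEEPING ([folklore]; 26 AT THE COMB DATA).  **EVERY LEVEL `j`, EVERY PERIOD `N`: THE `VH ⊗ VH` DIRECT AND SWAP WORDS OF THE bm CHART `X̃_j` ON THE TRANSPORTED SYM
BORDER SECTOR VANISH, BOND BY BOND IN THE CELL** — leaf-04 g66's GENERIC `VHWordsZeroBorder.sum_box_border_border_words_eq_zero` at the border table `S′ := 𝒯 S^VH_c`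
(`S^VH_c κ v = c • symVhSAt ρ_c d Lc κ v`, any `c` — at level `j+1` of the comb tower `c = cVH·wVH (j+1)`), its five sockets by §2–§3, the exit-face weights `𝟙f` `Lc`-periodic (`face_weight_periodic`):
with `X̃_j = unitK s_f s_m (coDressKBmAt ρ_c Lc (KInvStep Lc j))`, `Q_b := vertexOfK X̃_j Lc (unitS s_f s_m (𝒯 S^VH_c)) b`,
`Σ_{c ∈ box N} Σ'_{u′} FF[(Q_{(μ,c)} ∘ X̃_j) ∘ Q_{(ν,u′)}] = 0` and `Σ_{c ∈ box N} Σ'_{u′} FF[(Q_{(ν,u′)} ∘ X̃_j) ∘ Q_{(μ,c)}] = 0`.  By §1 `transport_unitS`, `unitS s_f s_m (𝒯 S^VH_c) = 𝒯 (unitS s_f s_m S^VH_c)`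
— the VH sector of the transported comb running table `𝒯 S̃′_{j+1}` (an2's `SpureCombOf` at level `j+1` = `(cE·wE)•e3OfK … + (cVH·wVH)•tabs.V`, `tabs.V = symVhSAt ρ_c` at an1's record). -/
theorem sum_box_symVhS_symVhS_words_eq_zero (sf sm c : ℝ) (j N : ℕ) :
    (∑ cb ∈ box (d + 1) N, ∑' u' : Site (d + 1), ∑' yw : Site (d + 1) × Site (d + 1),
        (if yw.1 α % (Lc : ℤ) = (Lc : ℤ) - 1 then (1 : ℝ) else 0) * (if yw.2 β % (Lc : ℤ) = (Lc : ℤ) - 1 then (1 : ℝ) else 0) *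
        comp (comp (vertexOfK (unitK sf sm (coDressKBmAt (ctr (d + 1) Lc) Lc (KInvStep (d := d) Lc j))) Lc
            (unitS sf sm (fun κ v => comp (comp (trK (psiKS (ctrOff (d + 1) Lc) Lc))
              (slotPsiS (ctrOff (d + 1) Lc) Lc (fun κ v => c • symVhSAt (ctr (d + 1) Lc) d Lc rfl κ v) κ v)) (psiKS (ctrOff (d + 1) Lc) Lc))) μ (toSite cb))
          (unitK sf sm (coDressKBmAt (ctr (d + 1) Lc) Lc (KInvStep (d := d) Lc j))))
          (vertexOfK (unitK sf sm (coDressKBmAt (ctr (d + 1) Lc) Lc (KInvStep (d := d) Lc j))) Lc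
            (unitS sf sm (fun κ v => comp (comp (trK (psiKS (ctrOff (d + 1) Lc) Lc))
              (slotPsiS (ctrOff (d + 1) Lc) Lc (fun κ v => c • symVhSAt (ctr (d + 1) Lc) d Lc rfl κ v) κ v)) (psiKS (ctrOff (d + 1) Lc) Lc))) ν u')
          yw.1 yw.2 (Sum.inl α) (Sum.inl β) = 0) ∧
    (∑ cb ∈ box (d + 1) N, ∑' u' : Site (d + 1), ∑' yw : Site (d + 1) × Site (d + 1),
        (if yw.1 α % (Lc : ℤ) = (Lc : ℤ) - 1 then (1 : ℝ) else 0) * (if yw.2 β % (Lc : ℤ) = (Lc : ℤ) - 1 then (1 : ℝ) else 0) *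
        comp (comp (vertexOfK (unitK sf sm (coDressKBmAt (ctr (d + 1) Lc) Lc (KInvStep (d := d) Lc j))) Lc
            (unitS sf sm (fun κ v => comp (comp (trK (psiKS (ctrOff (d + 1) Lc) Lc))
              (slotPsiS (ctrOff (d + 1) Lc) Lc (fun κ v => c • symVhSAt (ctr (d + 1) Lc) d Lc rfl κ v) κ v)) (psiKS (ctrOff (d + 1) Lc) Lc))) ν u')
          (unitK sf sm (coDressKBmAt (ctr (d + 1) Lc) Lc (KInvStep (d := d) Lc j))))
          (vertexOfK (unitK sf sm (coDressKBmAt (ctr (d + 1) Lc) Lc (KInvStep (d := d) Lc j))) Lc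
            (unitS sf sm (fun κ v => comp (comp (trK (psiKS (ctrOff (d + 1) Lc) Lc))
              (slotPsiS (ctrOff (d + 1) Lc) Lc (fun κ v => c • symVhSAt (ctr (d + 1) Lc) d Lc rfl κ v) κ v)) (psiKS (ctrOff (d + 1) Lc) Lc))) μ (toSite cb))
          yw.1 yw.2 (Sum.inl α) (Sum.inl β) = 0) := by
  have hLc : 1 ≤ Lc := Nat.one_le_iff_ne_zero.mpr (NeZero.ne Lc)
  obtain ⟨Cs, δs, hδs, hS⟩ := exists_locStencil_transport_symVhS (d := d) (Lc := Lc) c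
  exact sum_box_border_border_words_eq_zero (μ := μ) (ν := ν) (α := α) (β := β)
    (ρ₁ := fun y : Site (d + 1) => (if y α % (Lc : ℤ) = (Lc : ℤ) - 1 then (1 : ℝ) else 0))
    (ρ₂ := fun w : Site (d + 1) => (if w β % (Lc : ℤ) = (Lc : ℤ) - 1 then (1 : ℝ) else 0))
    hLc (ctrOff_mem_box pos_Lc) sf sm j hS hδs
    (transport_inl_inl (ctrOff (d + 1) Lc) (symVhS_inl_inl (Lc := Lc) c))
    (transport_translate (ctrOff (d + 1) Lc) pos_Lc (symVhS_translate hLc c))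
    (transport_inr_fst_eq_zero (ctrOff (d + 1) Lc) (symVhS_inr_fst_eq_zero (Lc := Lc) c))
    (transport_inr_snd_eq_zero (ctrOff (d + 1) Lc) (symVhS_inr_snd_eq_zero (Lc := Lc) c))
    (fun y => by split_ifs <;> simp) (fun w => by split_ifs <;> simp)
    (fun y s => face_weight_periodic Lc α y s) (fun w s => face_weight_periodic Lc β w s) N

end Words

end Summit.QuantumFields.BalabanUV.Beta.GAN24.CombTransportedBorder

end
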